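/-
Copyright (c) 2026 the pub-hodgecm-mathlib formalisation cell (harness21).  Prover seat hodgecm-mathlib-K2Liu-p02 (g7), Track B «K2-LIT» ∕ hLiu418
#184♮, #42S payer road (σ), V8-inst-A ORGAN I-0..I-3 (K2Liu-p09 (g6) 12:38:43Z; LEAD F0P6-plan (g14) BATCH #16∕#17: «I-1 = K2Liu-p02 (g7) NOW»), file I-1.
DEFINITION LANE (2 defs + theorems; like I-0).
-/
import Summits.HodgeConjecture.HodgeConjecture.Theorems.K2LiuLocalSWTensorAdaptedBlocks   -- ★ F5c-A (`matS∕matA_tensorEmbLoc`, kron block algebra; ★ D-A v1 `tensorEmbLoc`, `epsD`, `epsV`)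
import HarnessLib

/-!
# Crux `HLiu418`, (σ) V8-inst-A organ, file I-1: THE PARTNER EMBEDDING `ι′ : U(V′)(L⁺_v) →* U(𝔻 ⊗ V′)(L⁺_v)`, `g ↦ 1_𝔻 ⊗ g`, ITS ADAPTED BLOCKS
# (`A = D = 1 ⊗ g`, `B = C = 0` — block-diagonal) AND ITS COMMUTATION WITH `tensorEmbLoc h = h ⊗ 1_{V′}`

Cell `hodgecm-mathlib`, crux item hLiu418 = `stmt-HodgeConjecture-24832`; squad K2 ∕ K2Liu; prover K2Liu-p02 (g7).  DEFINITION LANE: two `def`s (`oneKronGLPi`,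
`oneKronInr` — the Literature-generic `1 ⊗ₖ g` twins of ★ `kronOneGL`∕`kronOneInl` of `LocalDoubledKroneckerEmbedding`) and one `def` at the K2Liu datum
(`partnerEmbLoc`, the twin of ★ D-A v1 `tensorEmbLoc`); everything else theorems; no instance, no notation, no `sorry`.

WHY (K2Liu-p09 (g6) V8-inst-A census 12:38:43Z; LEAD BATCH #16 (1)).  The (σ) instance of ★ V8e `face_two_of_laws` acts on the Δ-model `X = F_v^{n′+n′}` of the big doubled
space `𝔻 ⊗ V′` through TWO commuting embeddings into `U(𝔻 ⊗ V′)(L⁺_v)`: the doubled group `U(𝔻)` by `h ↦ h ⊗ 1` (★ `tensorEmbLoc`, adapted blocks ★ F5c-A) and the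
PARTNER `U(V′)` by `g ↦ 1 ⊗ g` (THIS FILE).  I-2 `K2LiuA7ValueInstanceDefs` (p09) sets `ρ := leviAct ∘ blkD ∘ matA ∘ ι′` and needs: `ι′` as a continuous hom (§1–§2), its adapted
matrix `matA (ι′ g) = reindex eΣ (1 ⊗ₖ m_g)` with blocks `A = D = reindex epsV (1 ⊗ₖ m_g)`, `B = C = 0` (§3: `ι′ g ∈ P_Δ ∩ {B = 0}` — the LEVI of the Siegel parabolic, so
`blkD` is multiplicative on its image), and `Commute (tensorEmbLoc h) (ι′ g)` (§2), `m_g` = the matrix of `g` over `L ⊗ L⁺_v = Π_{w∣v} L_w`.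
* §1 (Literature-generic, any CM∕quadratic `E∕F`, any `J_V, J_W`): `oneKronGLPi`, `coe_oneKronGLPi_apply`, `continuous_oneKronGLPi`, `oneKronGLPi_form`, `oneKronGLPi_mem`,
  `oneKronInr` (+ `coe_oneKronInr`, `continuous_oneKronInr`), `kronOneGL_mul_oneKronGLPi_comm`, `commute_kronOneInl_oneKronInr`.
* §2 (K2Liu datum `e dV dW ∕ eW e′ dV′`): **`partnerEmbLoc v : localPi L c M₂ (diag dV′) v →* localPi L c (n′+n′) (hermD ⊗) v`**, `coe_partnerEmbLoc`, `coe_partnerEmbLoc_apply`,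
  `continuous_partnerEmbLoc`, **`commute_tensorEmbLoc_partnerEmbLoc`**.
* §3 adapted blocks: `matS_partnerEmbLoc`, **`matA_partnerEmbLoc`**, **`blk_matA_partnerEmbLoc`** (`A, B = 0, C = 0, D`), `isSiegelDelta`-free (pure block facts).
References: [MoeglinVignerasWaldspurger1987] Chap. 1 I.17 (dual pairs `U(V) × U(W) → Sp(V ⊗ W)`); [Kudla1994] §2–§3; [GelbartRogawski1991] §3.2; [HarrisKudlaSweet1996] §1.
HONEST LABEL.  Count-neutral: `HC_CM` is proved only modulo the 7 printed citations (2 remaining named inputs: hLiu418 = `stmt-HodgeConjecture-24832`,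
h413 = `stmt-HodgeConjecture-24833`) until rung 0 closes.
-/

set_option autoImplicit false
set_option linter.dupNamespace false -- the mandated namespace repeats `HodgeConjecture.HodgeConjecture`

noncomputable section

open scoped Matrix Kronecker
open NumberField IsDedekindDomain Matrix
open Literature.NumberTheory.Automorphic Literature.NumberTheory.Automorphic.UnitaryGroup
open Literature.NumberTheory.GelbartRogawski1991 Literature.NumberTheory.GelbartRogawski1991.GRConstruction
open Literature.NumberTheory.GelbartRogawski1991.UnitaryDualPair
open Literature.NumberTheory.GelbartRogawski1991.UnitaryDualPair.LocalSplitting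
open Literature.NumberTheory.GelbartRogawski1991.AdaptedBlocks
open Literature.NumberTheory.K2Lit.SiegelDoubled
open Summit.HodgeConjecture.HodgeConjecture.Cruxes.HLiu418.K2LiuLocalSWSectionDefs
open Summit.HodgeConjecture.HodgeConjecture.Cruxes.HLiu418.K2LiuLocalSWTensorAdaptedBlocks

namespace Summit.HodgeConjecture.HodgeConjecture.Cruxes.HLiu418.K2LiuDeltaModelTensorBlocks

/-! ## §1 `g ↦ reindex e (1_N ⊗ₖ g)` on the local factors (the `1 ⊗ g` twin of ★ `kronOneGL` ∕ `kronOneInl`) -/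

section OneKron

variable (E : Type) [Field E] [NumberField E]

/-- `(g_w)_w ↦ (reindex e (1_N ⊗ₖ g_w))_w` on `Π_{w ∣ v} GL_m(E_w) → Π_{w ∣ v} GL_n(E_w)` — the second member of the dual pair. [cite: MoeglinVignerasWaldspurger1987, Chap. 1 I.17] -/
def oneKronGLPi (N m : ℕ) {n : ℕ} (e : Fin N × Fin m ≃ Fin n) {F : Type} [Field F] [NumberField F] [Algebra F E]
    (v : HeightOneSpectrum (𝓞 F)) : LocalGLPi E m v →* LocalGLPi E n v where
  toFun g w := UnitaryGroup.reindexGL e (kroneckerGL ((1 : GL (Fin N) (w.1.adicCompletion E)), g w))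
  map_one' := funext fun w => by rw [Pi.one_apply, Pi.one_apply, ← Prod.one_eq_mk, map_one, map_one]
  map_mul' g g' := funext fun w => by rw [Pi.mul_apply, Pi.mul_apply, ← map_mul, ← map_mul, Prod.mk_mul_mk, mul_one]

/-- matrix of the `w`-component: `reindex e e (1 ⊗ₖ g_w)`. [cite: MoeglinVignerasWaldspurger1987, Chap. 1 I.17] -/
theorem coe_oneKronGLPi_apply (N m : ℕ) {n : ℕ} (e : Fin N × Fin m ≃ Fin n) {F : Type} [Field F] [NumberField F] [Algebra F E]
    (v : HeightOneSpectrum (𝓞 F)) (g : LocalGLPi E m v) (w : PlacesOver E v) :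
    ((oneKronGLPi E N m e v g w : GL (Fin n) (w.1.adicCompletion E)) : Matrix (Fin n) (Fin n) (w.1.adicCompletion E)) =
      Matrix.reindex e e ((1 : Matrix (Fin N) (Fin N) (w.1.adicCompletion E)) ⊗ₖ
        ((g w : GL (Fin m) (w.1.adicCompletion E)) : Matrix (Fin m) (Fin m) (w.1.adicCompletion E))) := by
  rw [show oneKronGLPi E N m e v g w = UnitaryGroup.reindexGL e (kroneckerGL (1, g w)) from rfl, UnitaryGroup.coe_reindexGL,
    coe_kroneckerGL, Units.val_one]

/-- `oneKronGLPi` is continuous. [cite: MoeglinVignerasWaldspurger1987, Chap. 1 I.17] -/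
theorem continuous_oneKronGLPi (N m : ℕ) {n : ℕ} (e : Fin N × Fin m ≃ Fin n) {F : Type} [Field F] [NumberField F] [Algebra F E]
    (v : HeightOneSpectrum (𝓞 F)) : Continuous (oneKronGLPi E N m e v) :=
  continuous_pi fun w => (UnitaryGroup.continuous_reindexGL e).comp
    (continuous_kroneckerGL.comp ((continuous_const.prodMk (continuous_apply w))))

/-- the unitarity expression of `reindex e (1_N ⊗ g)` at `w` is `reindex e (J_V ⊗ ((c_* g)ᵀ J_W g))`:
`(c_*(1 ⊗ g))ᵀ (J_V ⊗ J_W) (1 ⊗ g) = (1ᵀ J_V 1) ⊗ ((c_* g)ᵀ J_W g)`. [cite: MoeglinVignerasWaldspurger1987, Chap. 1 I.17] -/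
theorem oneKronGLPi_form (N m : ℕ) {n : ℕ} (e : Fin N × Fin m ≃ Fin n) {F : Type} [Field F] [NumberField F] [Algebra F E]
    (c : E ≃ₐ[F] E) (JV : Matrix (Fin N) (Fin N) E) (JW : Matrix (Fin m) (Fin m) E)
    (v : HeightOneSpectrum (𝓞 F)) (g : LocalGLPi E m v) (w : PlacesOver E v) :
    (((oneKronGLPi E N m e v g (PlacesOver.galInv c w) : GL (Fin n) ((PlacesOver.galInv c w).1.adicCompletion E)) :
            Matrix (Fin n) (Fin n) ((PlacesOver.galInv c w).1.adicCompletion E)).map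
          (galAdicCompletionMap c (smul_inv_smul c w.1)))ᵀ * placeForm (Matrix.reindex e e (JV ⊗ₖ JW)) w.1 *
        ((oneKronGLPi E N m e v g w : GL (Fin n) (w.1.adicCompletion E)) : Matrix (Fin n) (Fin n) (w.1.adicCompletion E)) =
      Matrix.reindex e e
        (placeForm JV w.1 ⊗ₖ
          ((((g (PlacesOver.galInv c w) : GL (Fin m) ((PlacesOver.galInv c w).1.adicCompletion E)) :
                Matrix (Fin m) (Fin m) ((PlacesOver.galInv c w).1.adicCompletion E)).map
              (galAdicCompletionMap c (smul_inv_smul c w.1)))ᵀ * placeForm JW w.1 *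
            ((g w : GL (Fin m) (w.1.adicCompletion E)) : Matrix (Fin m) (Fin m) (w.1.adicCompletion E)))) := by
  rw [coe_oneKronGLPi_apply, coe_oneKronGLPi_apply, placeForm_reindex_kronecker_general, Matrix.reindex_apply,
    Matrix.reindex_apply, Matrix.reindex_apply, Matrix.reindex_apply, ← Matrix.submatrix_map, Matrix.transpose_submatrix,
    ← kronecker_map_map, kronecker_transpose, Matrix.map_one _ (map_zero _) (map_one _), Matrix.transpose_one,
    Matrix.submatrix_mul_equiv,
    Matrix.submatrix_mul_equiv, ← Matrix.mul_kronecker_mul, ← Matrix.mul_kronecker_mul, Matrix.one_mul, Matrix.mul_one]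

/-- **`reindex e (1_N ⊗ g) ∈ U(J_V ⊗ J_W)(F_v)` for `g ∈ U(J_W)(F_v)`** (any `J_V ∈ M_N(E)`). [cite: MoeglinVignerasWaldspurger1987, Chap. 1 I.17] -/
theorem oneKronGLPi_mem (N m : ℕ) {n : ℕ} (e : Fin N × Fin m ≃ Fin n) {F : Type} [Field F] [NumberField F] [Algebra F E]
    (c : E ≃ₐ[F] E) (JV : Matrix (Fin N) (Fin N) E) (JW : Matrix (Fin m) (Fin m) E)
    (v : HeightOneSpectrum (𝓞 F)) (g : localPi E c m JW v) :
    oneKronGLPi E N m e v (g : LocalGLPi E m v) ∈ localPi E c n (Matrix.reindex e e (JV ⊗ₖ JW)) v := by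
  rw [mem_localPi_iff]
  intro w
  rw [oneKronGLPi_form, (mem_localPi_iff E c m JW v (g : LocalGLPi E m v)).1 g.2 w, placeForm_reindex_kronecker_general]

/-- **`oneKronInr … v : U(J_W)(F_v) →* U(J_V ⊗ J_W)(F_v)`, `g ↦ reindex e (1_N ⊗ g)`** — the second member of the dual pair `U(J_V) × U(J_W) → U(J_V ⊗ J_W)` at the
place `v` restricted to `1 × U(J_W)`. [cite: MoeglinVignerasWaldspurger1987, Chap. 1 I.17] [cite: GelbartRogawski1991, §3.2 p. 457] -/
def oneKronInr (N m : ℕ) {n : ℕ} (e : Fin N × Fin m ≃ Fin n) {F : Type} [Field F] [NumberField F] [Algebra F E]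
    (c : E ≃ₐ[F] E) (JV : Matrix (Fin N) (Fin N) E) (JW : Matrix (Fin m) (Fin m) E) (v : HeightOneSpectrum (𝓞 F)) :
    localPi E c m JW v →* localPi E c n (Matrix.reindex e e (JV ⊗ₖ JW)) v :=
  ((oneKronGLPi E N m e v).comp (localPi E c m JW v).subtype).codRestrict _ fun g => oneKronGLPi_mem E N m e c JV JW v g

/-- underlying family of `oneKronInr v g`. [cite: MoeglinVignerasWaldspurger1987, Chap. 1 I.17] -/
@[simp] theorem coe_oneKronInr (N m : ℕ) {n : ℕ} (e : Fin N × Fin m ≃ Fin n) {F : Type} [Field F] [NumberField F] [Algebra F E]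
    (c : E ≃ₐ[F] E) (JV : Matrix (Fin N) (Fin N) E) (JW : Matrix (Fin m) (Fin m) E) (v : HeightOneSpectrum (𝓞 F))
    (g : localPi E c m JW v) :
    ((oneKronInr E N m e c JV JW v g : localPi E c n (Matrix.reindex e e (JV ⊗ₖ JW)) v) : LocalGLPi E n v) =
      oneKronGLPi E N m e v (g : LocalGLPi E m v) := rfl

/-- `g ↦ reindex e (1 ⊗ g)` is continuous on `U(J_W)(F_v)`. [cite: MoeglinVignerasWaldspurger1987, Chap. 1 I.17] -/
theorem continuous_oneKronInr (N m : ℕ) {n : ℕ} (e : Fin N × Fin m ≃ Fin n) {F : Type} [Field F] [NumberField F] [Algebra F E]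
    (c : E ≃ₐ[F] E) (JV : Matrix (Fin N) (Fin N) E) (JW : Matrix (Fin m) (Fin m) E) (v : HeightOneSpectrum (𝓞 F)) :
    Continuous (oneKronInr E N m e c JV JW v) :=
  Topology.IsInducing.subtypeVal.continuous_iff.2 ((continuous_oneKronGLPi E N m e v).comp continuous_subtype_val)

/-- **THE TWO MEMBERS OF THE DUAL PAIR COMMUTE**: `(k ⊗ 1)(1 ⊗ g) = k ⊗ g = (1 ⊗ g)(k ⊗ 1)` on `Π_{w∣v} GL_n(E_w)`. [cite: MoeglinVignerasWaldspurger1987, Chap. 1 I.17] -/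
theorem kronOneGL_mul_oneKronGLPi_comm (N m : ℕ) {n : ℕ} (e : Fin N × Fin m ≃ Fin n) {F : Type} [Field F] [NumberField F] [Algebra F E]
    (v : HeightOneSpectrum (𝓞 F)) (k : LocalGLPi E N v) (g : LocalGLPi E m v) :
    kronOneGL E N m e v k * oneKronGLPi E N m e v g = oneKronGLPi E N m e v g * kronOneGL E N m e v k := by
  funext w
  apply Units.ext
  rw [Pi.mul_apply, Pi.mul_apply, Units.val_mul, Units.val_mul, coe_kronOneGL_apply, coe_oneKronGLPi_apply, Matrix.reindex_apply,
    Matrix.reindex_apply, Matrix.submatrix_mul_equiv, Matrix.submatrix_mul_equiv, ← Matrix.mul_kronecker_mul, ← Matrix.mul_kronecker_mul,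
    Matrix.one_mul, Matrix.mul_one, Matrix.one_mul, Matrix.mul_one]

/-- the same inside `U(J_V ⊗ J_W)(F_v)`: `Commute (kronOneInl k) (oneKronInr g)`. [cite: MoeglinVignerasWaldspurger1987, Chap. 1 I.17] -/
theorem commute_kronOneInl_oneKronInr (N m : ℕ) {n : ℕ} (e : Fin N × Fin m ≃ Fin n) {F : Type} [Field F] [NumberField F] [Algebra F E]
    (c : E ≃ₐ[F] E) (JV : Matrix (Fin N) (Fin N) E) (JW : Matrix (Fin m) (Fin m) E) (v : HeightOneSpectrum (𝓞 F))
    (k : localPi E c N JV v) (g : localPi E c m JW v) :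
    Commute (kronOneInl E N m e c JV JW v k) (oneKronInr E N m e c JV JW v g) :=
  Subtype.ext (kronOneGL_mul_oneKronGLPi_comm E N m e v (k : LocalGLPi E N v) (g : LocalGLPi E m v))

end OneKron

/-! ## §2 The partner embedding `ι′ = partnerEmbLoc v : U(V′)(L⁺_v) →* U(𝔻 ⊗ V′)(L⁺_v)` at the K2Liu datum -/

section CM

variable (L : Type) [Field L] [NumberField L] [IsCMField L]
variable {N M n : ℕ} (e : Fin N × Fin M ≃ Fin n)
  (dV : Fin N → L) (hdV : ∀ i, IsCMField.complexConj L (dV i) = dV i)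
  (dW : Fin M → L) (hdW : ∀ i, IsCMField.complexConj L (dW i) = dW i)
variable {M₂ M' n' : ℕ} (eW : Fin M × Fin M₂ ≃ Fin M') (e' : Fin N × Fin M' ≃ Fin n')
  (dV' : Fin M₂ → L) (hdV' : ∀ k, IsCMField.complexConj L (dV' k) = dV' k)
variable (v : HeightOneSpectrum (𝓞 (Fp L)))

/-- **`partnerEmbLoc v : U(V′)(L⁺_v) →* U(𝔻 ⊗ V′)(L⁺_v)`, `g ↦ reindex epsD (1_𝔻 ⊗ₖ g)`** (`V′ = (L^{M₂}, diag dV′)`; ★ `oneKronInr` at `e := epsD`, `J_V := J^𝔻`, `J_W := diag dV′`,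
read on `U(J^{𝔻⊗V′})(L⁺_v)` through ★ `localPi_hermD_tensor_eq`) — the partner of ★ `tensorEmbLoc`. [cite: Kudla1994, §2 (doubled space, Siegel parabolic), §3]
[cite: MoeglinVignerasWaldspurger1987, Chap. 1 I.17] -/
def partnerEmbLoc :
    UnitaryGroup.localPi L (IsCMField.complexConj L) M₂ (Matrix.diagonal dV') v →*
      UnitaryGroup.localPi L (IsCMField.complexConj L) (n' + n')
        (hermD L e' dV hdV (tensorFrame L dW eW dV') (tensorFrame_real L dW hdW eW dV' hdV')) v :=
  (MulEquiv.subgroupCongr (localPi_hermD_tensor_eq L e dV hdV dW hdW eW e' dV' hdV' v)).toMonoidHom.comp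
    (oneKronInr L (n + n) M₂ (epsD e eW e') (IsCMField.complexConj L) (hermD L e dV hdV dW hdW) (Matrix.diagonal dV') v)

/-- underlying family of `partnerEmbLoc v g`: `oneKronGLPi` of the family of `g`. [cite: MoeglinVignerasWaldspurger1987, Chap. 1 I.17] -/
theorem coe_partnerEmbLoc (g : UnitaryGroup.localPi L (IsCMField.complexConj L) M₂ (Matrix.diagonal dV') v) :
    ((partnerEmbLoc L e dV hdV dW hdW eW e' dV' hdV' v g :
        UnitaryGroup.localPi L (IsCMField.complexConj L) (n' + n')
          (hermD L e' dV hdV (tensorFrame L dW eW dV') (tensorFrame_real L dW hdW eW dV' hdV')) v) : UnitaryGroup.LocalGLPi L (n' + n') v) =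
      oneKronGLPi L (n + n) M₂ (epsD e eW e') v (g : UnitaryGroup.LocalGLPi L M₂ v) :=
  rfl

/-- **the matrix of `(partnerEmbLoc v g)_w` is `reindex epsD epsD (1 ⊗ₖ g_w)`**. [cite: Kudla1994, §2 (doubled space, Siegel parabolic)] -/
theorem coe_partnerEmbLoc_apply (g : UnitaryGroup.localPi L (IsCMField.complexConj L) M₂ (Matrix.diagonal dV') v) (w : UnitaryGroup.PlacesOver L v) :
    ((((partnerEmbLoc L e dV hdV dW hdW eW e' dV' hdV' v g :
        UnitaryGroup.localPi L (IsCMField.complexConj L) (n' + n')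
          (hermD L e' dV hdV (tensorFrame L dW eW dV') (tensorFrame_real L dW hdW eW dV' hdV')) v) : UnitaryGroup.LocalGLPi L (n' + n') v) w :
        GL (Fin (n' + n')) (w.1.adicCompletion L)) : Matrix (Fin (n' + n')) (Fin (n' + n')) (w.1.adicCompletion L)) =
      Matrix.reindex (epsD e eW e') (epsD e eW e')
        ((1 : Matrix (Fin (n + n)) (Fin (n + n)) (w.1.adicCompletion L)) ⊗ₖ
          (((g : UnitaryGroup.LocalGLPi L M₂ v) w : GL (Fin M₂) (w.1.adicCompletion L)) : Matrix (Fin M₂) (Fin M₂) (w.1.adicCompletion L))) := by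
  rw [coe_partnerEmbLoc]
  exact coe_oneKronGLPi_apply L (n + n) M₂ (epsD e eW e') v (g : UnitaryGroup.LocalGLPi L M₂ v) w

/-- `partnerEmbLoc v` is continuous. [cite: MoeglinVignerasWaldspurger1987, Chap. 1 I.17] -/
theorem continuous_partnerEmbLoc : Continuous (partnerEmbLoc L e dV hdV dW hdW eW e' dV' hdV' v) := by
  refine Topology.IsInducing.subtypeVal.continuous_iff.2 ?_
  exact ((continuous_oneKronGLPi L (n + n) M₂ (epsD e eW e') v).comp continuous_subtype_val).congr
    fun g => (coe_partnerEmbLoc L e dV hdV dW hdW eW e' dV' hdV' v g).symm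

/-- **`h ⊗ 1` AND `1 ⊗ g` COMMUTE** in `U(𝔻 ⊗ V′)(L⁺_v)`. [cite: MoeglinVignerasWaldspurger1987, Chap. 1 I.17] [cite: Kudla1994, §3] -/
theorem commute_tensorEmbLoc_partnerEmbLoc (h : UnitaryGroup.localPi L (IsCMField.complexConj L) (n + n) (hermD L e dV hdV dW hdW) v)
    (g : UnitaryGroup.localPi L (IsCMField.complexConj L) M₂ (Matrix.diagonal dV') v) :
    Commute (tensorEmbLoc L e dV hdV dW hdW eW e' dV' hdV' v h) (partnerEmbLoc L e dV hdV dW hdW eW e' dV' hdV' v g) := by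
  apply Subtype.ext
  show (((tensorEmbLoc L e dV hdV dW hdW eW e' dV' hdV' v h * partnerEmbLoc L e dV hdV dW hdW eW e' dV' hdV' v g : UnitaryGroup.localPi L
      (IsCMField.complexConj L) (n' + n') (hermD L e' dV hdV (tensorFrame L dW eW dV') (tensorFrame_real L dW hdW eW dV' hdV')) v)) :
        UnitaryGroup.LocalGLPi L (n' + n') v) = _
  rw [Subgroup.coe_mul, Subgroup.coe_mul, coe_tensorEmbLoc, coe_partnerEmbLoc]
  exact kronOneGL_mul_oneKronGLPi_comm L (n + n) M₂ (epsD e eW e') v _ _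

/-! ## §3 The adapted blocks of `1 ⊗ g`: `A = D = reindex epsV (1 ⊗ₖ m_g)`, `B = C = 0` -/

/-- **the matrix of `1 ⊗ g` over `Π_{w∣v} L_w` is `reindex epsD epsD (1 ⊗ₖ m_g)`**, `m_g` = the matrix of `g` over `L ⊗ L⁺_v` (★ `localPiEquiv`). [cite: Kudla1994, §3] -/
theorem matS_partnerEmbLoc (g : UnitaryGroup.localPi L (IsCMField.complexConj L) M₂ (Matrix.diagonal dV') v) :
    matS (Fp L) L (IsCMField.complexConj L) v n' (partnerEmbLoc L e dV hdV dW hdW eW e' dV' hdV' v g) =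
      Matrix.reindex (epsD e eW e') (epsD e eW e') ((1 : Matrix (Fin (n + n)) (Fin (n + n)) (LocalRing L v)) ⊗ₖ (((UnitaryGroup.localPiEquiv L (IsCMField.complexConj L) M₂ (Matrix.diagonal dV') v g).1 : GL (Fin M₂) (LocalRing L v)).1 : Matrix (Fin M₂) (Fin M₂) (LocalRing L v))) := by
  refine Matrix.ext fun i j => funext fun w => ?_
  have hl := congrFun (congrFun (matS_map_eval (Fp L) L (IsCMField.complexConj L) v n' (partnerEmbLoc L e dV hdV dW hdW eW e' dV' hdV' v g) w) i) j
  have hr : ∀ a b, (((g : UnitaryGroup.LocalGLPi L M₂ v) w : GL (Fin M₂) (w.1.adicCompletion L)) : Matrix (Fin M₂) (Fin M₂) (w.1.adicCompletion L)) a b = (((UnitaryGroup.localPiEquiv L (IsCMField.complexConj L) M₂ (Matrix.diagonal dV') v g).1 : GL (Fin M₂) (LocalRing L v)).1 : Matrix (Fin M₂) (Fin M₂) (LocalRing L v)) a b w := by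
    intro a b
    have h := GLn.map_piEquiv_symm (fun w'' : UnitaryGroup.PlacesOver L v => w''.1.adicCompletion L) _ (g : UnitaryGroup.LocalGLPi L M₂ v) w
    rw [← UnitaryGroup.coe_localPiEquiv_apply] at h
    have h' := congrFun (congrFun h a) b
    rw [Matrix.map_apply, Pi.evalRingHom_apply] at h'
    exact h'.symm
  simp only [Matrix.map_apply, Pi.evalRingHom_apply] at hl
  rw [hl, coe_partnerEmbLoc_apply, Matrix.reindex_apply, Matrix.reindex_apply, Matrix.submatrix_apply, Matrix.submatrix_apply,
    Matrix.kroneckerMap_apply, Matrix.kroneckerMap_apply, Pi.mul_apply, hr, Matrix.one_apply, Matrix.one_apply]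
  split_ifs <;> rfl

/-- **THE ADAPTED MATRIX OF `1 ⊗ g`**: `matA n′ (1 ⊗ g) = reindex (eΣ epsV) (eΣ epsV) (1 ⊗ₖ m_g)` (as ★ `matA_tensorEmbLoc`: `epsD = e₂′ ∘ eΣ ∘ (e₂⁻¹ × 1)`). [cite: Kudla1994, §3] -/
theorem matA_partnerEmbLoc (g : UnitaryGroup.localPi L (IsCMField.complexConj L) M₂ (Matrix.diagonal dV') v) :
    matA (Fp L) L (IsCMField.complexConj L) v n' (partnerEmbLoc L e dV hdV dW hdW eW e' dV' hdV' v g) =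
      Matrix.reindex ((Equiv.sumProdDistrib (Fin n) (Fin n) (Fin M₂)).trans ((epsV e eW e').sumCongr (epsV e eW e'))) ((Equiv.sumProdDistrib (Fin n) (Fin n) (Fin M₂)).trans ((epsV e eW e').sumCongr (epsV e eW e'))) ((1 : Matrix (Fin n ⊕ Fin n) (Fin n ⊕ Fin n) (LocalRing L v)) ⊗ₖ (((UnitaryGroup.localPiEquiv L (IsCMField.complexConj L) M₂ (Matrix.diagonal dV') v g).1 : GL (Fin M₂) (LocalRing L v)).1 : Matrix (Fin M₂) (Fin M₂) (LocalRing L v))) := by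
  rw [matA, matS_partnerEmbLoc]
  ext s t
  rcases s with i | i <;> rcases t with j | j <;>
    obtain ⟨⟨x, k⟩, rfl⟩ := (epsV e eW e').surjective i <;> obtain ⟨⟨y, l⟩, rfl⟩ := (epsV e eW e').surjective j <;>
    simp only [Matrix.reindex_apply, Matrix.submatrix_apply, Equiv.symm_symm, Matrix.kroneckerMap_apply, Equiv.symm_trans_apply,
      Equiv.sumCongr_symm, Equiv.sumCongr_apply, Sum.map_inl, Sum.map_inr, Equiv.sumProdDistrib_symm_apply_left,
      Equiv.sumProdDistrib_symm_apply_right, ← epsD_inl, ← epsD_inr, Equiv.symm_apply_apply, Matrix.one_apply, Sum.inl.injEq, Sum.inr.injEq,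
      reduceCtorEq, (GRConstruction.e₂ (n := n)).injective.eq_iff]

set_option maxHeartbeats 400000 in
/-- **THE ADAPTED BLOCKS OF `1 ⊗ g`** — block-diagonal, the same block twice: `A(1 ⊗ g) = D(1 ⊗ g) = reindex epsV (1 ⊗ₖ m_g)`, `B(1 ⊗ g) = C(1 ⊗ g) = 0`
(so `1 ⊗ g ∈ P_Δ`, ★ `isSiegelDelta_iff_blkC_eq_zero`, indeed in its Levi, and `blkD` is multiplicative on the image of `ι′`). [cite: Kudla1994, §3] -/
theorem blk_matA_partnerEmbLoc (g : UnitaryGroup.localPi L (IsCMField.complexConj L) M₂ (Matrix.diagonal dV') v) :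
    blkA (matA (Fp L) L (IsCMField.complexConj L) v n' (partnerEmbLoc L e dV hdV dW hdW eW e' dV' hdV' v g)) =
        Matrix.reindex (epsV e eW e') (epsV e eW e') ((1 : Matrix (Fin n) (Fin n) (LocalRing L v)) ⊗ₖ (((UnitaryGroup.localPiEquiv L (IsCMField.complexConj L) M₂ (Matrix.diagonal dV') v g).1 : GL (Fin M₂) (LocalRing L v)).1 : Matrix (Fin M₂) (Fin M₂) (LocalRing L v))) ∧
      blkB (matA (Fp L) L (IsCMField.complexConj L) v n' (partnerEmbLoc L e dV hdV dW hdW eW e' dV' hdV' v g)) = 0 ∧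
      blkC (matA (Fp L) L (IsCMField.complexConj L) v n' (partnerEmbLoc L e dV hdV dW hdW eW e' dV' hdV' v g)) = 0 ∧
      blkD (matA (Fp L) L (IsCMField.complexConj L) v n' (partnerEmbLoc L e dV hdV dW hdW eW e' dV' hdV' v g)) =
        Matrix.reindex (epsV e eW e') (epsV e eW e') ((1 : Matrix (Fin n) (Fin n) (LocalRing L v)) ⊗ₖ (((UnitaryGroup.localPiEquiv L (IsCMField.complexConj L) M₂ (Matrix.diagonal dV') v g).1 : GL (Fin M₂) (LocalRing L v)).1 : Matrix (Fin M₂) (Fin M₂) (LocalRing L v))) := by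
  obtain ⟨hA, hB, hC, hD⟩ := blk_reindex_kronecker (epsV e eW e') (1 : Matrix (Fin n ⊕ Fin n) (Fin n ⊕ Fin n) (LocalRing L v)) (((UnitaryGroup.localPiEquiv L (IsCMField.complexConj L) M₂ (Matrix.diagonal dV') v g).1 : GL (Fin M₂) (LocalRing L v)).1 : Matrix (Fin M₂) (Fin M₂) (LocalRing L v))
  rw [matA_partnerEmbLoc, hA, hB, hC, hD, blkA_one, blkB_one, blkC_one, blkD_one]
  refine ⟨rfl, ?_, ?_, rfl⟩ <;> rw [Matrix.zero_kronecker, Matrix.reindex_apply, Matrix.submatrix_zero] <;> rfl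

end CM

end Summit.HodgeConjecture.HodgeConjecture.Cruxes.HLiu418.K2LiuDeltaModelTensorBlocks

end
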